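import Summits.RiemannHypothesis.RiemannHypothesis.Theorems.GroundBartaEvenWinsBeyondArchDeflationRN83ESharedA
import Summits.RiemannHypothesis.RiemannHypothesis.Theorems.GroundBartaEvenWinsBeyondArchDeflationRN83ESharedB
import HarnessLib

/-!
# RiemannHypothesis / GroundBarta — rung 4 (`EvenWinsBeyondArch`): R-layer certificate of cell `RN83E` — vector-independent kernel facts

Generated by `tools/rgen/gen4.py` = prover A g12's four-slot ((2, 3, 4, 5)-window) port of prover B's `tools/rgen/gen.py shared` (prover B / A g12): pole-quadrature checks, switch-point and constant-flag certificates of the split y-panels, parity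
of the vectors.  (Stated once here so that the per-vector files do not restate them.)
-/

set_option linter.dupNamespace false

noncomputable section

open MeasureTheory Set Filter intervalIntegral
open scoped Topology BigOperators

namespace Summit.RiemannHypothesis.RiemannHypothesis.Theorems.EvenWinsBeyondArch

open Literature.NumberTheory.LFunctions
open Literature.Analysis.ValidatedNumerics Literature.Analysis.ValidatedNumerics.PolyMP
  Literature.Analysis.ValidatedNumerics.NumericsMP Literature.Analysis.ValidatedNumerics.ExpPoly
set_option maxRecDepth 200000 in
set_option maxHeartbeats 4000000 in
/-- switch-point certificate of y-panel 16 (slot 4, minus) -/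
theorem re83sw16 : dt_switchMinusCheck re83S re83c (re83c / (2 * re83m)) (PolyMP.panelCentre (re83c / (2 * re83m)) 16) re83IL4 (((1019648355660874810664428282323099929457372326263 : ℚ)/54806311399908859432638181226860613237097470361600)) (((1019648355660874810664428282323099929457372346363 : ℚ)/54806311399908859432638181226860613237097470361600)) = true := by decide +kernel

set_option maxRecDepth 200000 in
set_option maxHeartbeats 4000000 in
/-- constant flag on y-panel 16: slot 1, copy `M` -/
theorem re83fM0x16 : dt_flagMinus re83S re83c (re83c / (2 * re83m)) (PolyMP.panelCentre (re83c / (2 * re83m)) 16) re83IL1 = some true := by decide +kernel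

set_option maxRecDepth 200000 in
set_option maxHeartbeats 4000000 in
/-- constant flag on y-panel 16: slot 1, copy `P` -/
theorem re83fP0x16 : dt_flagPlus re83S re83c (re83c / (2 * re83m)) (PolyMP.panelCentre (re83c / (2 * re83m)) 16) re83IL1 = some false := by decide +kernel

set_option maxRecDepth 200000 in
set_option maxHeartbeats 4000000 in
/-- constant flag on y-panel 16: slot 2, copy `M` -/
theorem re83fM1x16 : dt_flagMinus re83S re83c (re83c / (2 * re83m)) (PolyMP.panelCentre (re83c / (2 * re83m)) 16) re83IL2 = some true := by decide +kernel

set_option maxRecDepth 200000 in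
set_option maxHeartbeats 4000000 in
/-- constant flag on y-panel 16: slot 2, copy `P` -/
theorem re83fP1x16 : dt_flagPlus re83S re83c (re83c / (2 * re83m)) (PolyMP.panelCentre (re83c / (2 * re83m)) 16) re83IL2 = some false := by decide +kernel

set_option maxRecDepth 200000 in
set_option maxHeartbeats 4000000 in
/-- constant flag on y-panel 16: slot 3, copy `M` -/
theorem re83fM2x16 : dt_flagMinus re83S re83c (re83c / (2 * re83m)) (PolyMP.panelCentre (re83c / (2 * re83m)) 16) re83IL3 = some true := by decide +kernel

set_option maxRecDepth 200000 in
set_option maxHeartbeats 4000000 in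
/-- constant flag on y-panel 16: slot 3, copy `P` -/
theorem re83fP2x16 : dt_flagPlus re83S re83c (re83c / (2 * re83m)) (PolyMP.panelCentre (re83c / (2 * re83m)) 16) re83IL3 = some false := by decide +kernel

set_option maxRecDepth 200000 in
set_option maxHeartbeats 4000000 in
/-- constant flag on y-panel 16: slot 4, copy `P` -/
theorem re83fP3x16 : dt_flagPlus re83S re83c (re83c / (2 * re83m)) (PolyMP.panelCentre (re83c / (2 * re83m)) 16) re83IL4 = some false := by decide +kernel


/-- all vectors are even -/
theorem re83gp_even : ∀ i, dt_parityCheck false (re83gp i) = true := by decide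
end Summit.RiemannHypothesis.RiemannHypothesis.Theorems.EvenWinsBeyondArch

end
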